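import Summits.ValiantsHypothesis.ValiantsHypothesis.Theorems.ValuativeGCTValuativeFlipDetEffectiveMonotone
import Literature.Computability.AlgebraicComplexity.PermanentVsDeterminantProofs
import Literature.Computability.AlgebraicComplexity.OrbitClosureProofs
import Literature.Computability.Complexity.OccurrenceObstructionsBIP

/-!
# Inner multiplicities versus the padded determinant: an effective transfer and the
# "inner obstruction" principle (crux `ValuativeGCT.ValuativeFlip`, stmt-ValiantsHypothesis-12624;
# wall-breaker axis "representation-stability transfer `m ↔ m + 1`", k16 gen 1, seat 3; sequel to
# `…DetEffectiveMonotone.lean`)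

The derivative-preimage engine of `…DetEffectiveMonotone.lean` is not specific to `p = det_m`: for ANY
form `p` of degree `m` on `Mat_m` with an affine determinantal expression of size `s`, every translate
`A · p` is `(∂_top^j q')|segment` for some `q' ∈ Δ(det_{m+j})` once `m + j ≥ (m+1)·2(s+1)^9 + 1`, so the
Kadish–Landsberg lift gives, UNTWISTED and at an explicit level,

* `orbitMultiplicity_le_det_rowLift_of_hasDetRepr` — `mult_{λ*} ℂ[Δ_m(p)] ≤ K_{m+j}((λ♯(m+j))*)` for all
  `λ ⊢ mδ` (`≤ m²` parts) and all `j` with `m + j ≥ (m+1)·2(s+1)^9 + 1`, `s ≥ 1` any size with `HasDetRepr p s`.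

For the permanent (`p = per_n = paddedPerFormLex ℂ n n`, `P_n(μ) = mult_{μ*} ℂ[Δ_n(per_n)]`):

* `per_inner_le_det_rowLift_of_hasDetRepr` — `dc(per_n) ≤ s` ⟹ `P_n(μ) ≤ K_{n+j}((μ♯)*)` for every
  `μ` and every `n + j ≥ (n+1)·2(s+1)^9 + 1`;
* `per_inner_le_det_rowLift_grenet` — unconditionally (Grenet, `dc(per_n) ≤ 2ⁿ - 1`) for
  `n + j ≥ (n+1)·2^{9n+1} + 1` (an explicit level for the tree's `P_n(μ) ≤ K∞(μ)`, `…RayStability.lean`);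
* `lt_determinantalComplexity_perPoly_of_innerObstruction` — **the inner obstruction principle**: an
  INNER multiplicity obstruction on a Kadish–Landsberg ray, `K_{n+j}((μ♯(n+j))*) < P_n(μ)` (the unpadded
  permanent `per_n` against the determinant `det_{n+j}` on the lifted shape), forces
  `dc(per_n) > s` for every `s ≥ 1` with `(n+1)·2(s+1)^9 + 1 ≤ n + j`, i.e. `dc(per_n) ≳ ((n+j)/(2(n+1)))^{1/9}`.
  Compare the padded (border) principle `K_m(λ) < mult_λ ℂ[Δ_m(X^{m-n} per_n)] ⟹ \underline{dc}(per_n) > m`: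
  the inner version needs no padded permanent and no orbit-closure membership, at the price of the ninth
  root; inner obstructions at quasi-polynomial levels `n + j` along any shapes `μ(n)` would still give
  Valiant's hypothesis in the form `dc(per_n)` super-polynomial.

Sources: Mulmuley–Sohoni 2001 Prop. 4.4; BLMW 2011 §6.4; Kadish–Landsberg 2014 §1; Ikenmeyer–Panova 2017
Prop. 2.6(b); Bürgisser–Ikenmeyer–Panova 2019 §5; Grenet 2011 Thm. 1.
-/

set_option linter.dupNamespace false

namespace Summit.ValiantsHypothesis.ValiantsHypothesis.Theorems.ValuativeFlip

open scoped BigOperators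
open MvPolynomial
open Literature.NumberTheory.DiophantineGeometry
open Literature.Computability.AlgebraicComplexity
open Literature.Computability.Complexity

noncomputable section

/-- **Untwisted, effective Kadish–Landsberg transfer into the determinant.**  For a form `p` of degree
`m` on `Mat_m` with an affine determinantal expression of size `s ≥ 1`, every `λ ⊢ mδ` with at most `m²`
parts and every `j` with `m + j ≥ (m+1)·2(s+1)^9 + 1`:
`mult_{λ*} ℂ[Δ_m(p)] ≤ mult_{(λ♯(m+j))*} ℂ[Δ(det_{m+j})]` (padding lift modulo derivative preimages, k12,
fed with `exists_derivPreimage_of_hasDetRepr` for the translates `A · p`, `HasDetRepr (A · p) s`).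
[Ikenmeyer–Panova 2017 Prop. 2.6(b); Mulmuley–Sohoni 2001 Prop. 4.4; this crux, k12 + k16] -/
theorem orbitMultiplicity_le_det_rowLift_of_hasDetRepr {m : ℕ} [NeZero m] {p : MvPolynomial (MatIdx m) ℂ}
    (hp : p.IsHomogeneous m) {s : ℕ} (hs : 1 ≤ s) (hdet : HasDetRepr p s)
    {δ : ℕ} (lam : Nat.Partition (m * δ)) (hlam : lam.parts.card ≤ m * m)
    (j : ℕ) [NeZero (m + j)] (hj : (m + 1) * (2 * (s + 1) ^ 9) + 1 ≤ m + j) :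
    orbitMultiplicity ℂ p m (partitionWeightLex m lam) ≤
      orbitMultiplicity ℂ (detFormLex ℂ (m + j)) (m + j) (partitionWeightLex (m + j) (rowLift lam j)) := by
  refine orbitMultiplicity_le_rowLift_of_derivPreimage j (detFormLex_isHomogeneous ℂ (m + j))
    (fun h => Matrix.det_mvPolynomialX_ne_zero (m := Fin (m + j)) (R := ℂ)
      (rename_injective _ toLex.injective (h.trans (map_zero _).symm))) lam hlam fun g => ?_
  rw [linSubstRep_apply]
  exact exists_derivPreimage_of_hasDetRepr j (linSubst_isHomogeneous _ hp) hs (hasDetRepr_linSubst _ hdet) hj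

/-- `per_n` in the lexicographic matrix variables (`paddedPerFormLex ℂ n n = X₀₀⁰ · per_n(block)`) is a
renaming of `perPoly (Fin n) ℂ`, hence inherits its affine determinantal expressions
(`HasDetRepr.of_isProjection_holds`). [folklore] -/
theorem hasDetRepr_paddedPerFormLex_self {n s : ℕ} [NeZero n] (h : HasDetRepr (perPoly (Fin n) ℂ) s) :
    HasDetRepr (paddedPerFormLex ℂ n n) s := by
  classical
  -- `BlockIdx n n` is all of `Fin n`
  let e : Fin n ≃ BlockIdx n n :=
    { toFun := fun i => ⟨i, by simp⟩
      invFun := fun i => (i : Fin n)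
      left_inv := fun i => rfl
      right_inv := fun i => Subtype.ext rfl }
  have hper : perPoly (BlockIdx n n) ℂ = rename (Prod.map e e) (perPoly (Fin n) ℂ) :=
    (rename_perPoly_equiv (k := ℂ) e).symm
  set F : Fin n × Fin n → MatIdx n :=
    (fun ij : BlockIdx n n × BlockIdx n n => (toLex ((ij.1 : Fin n), (ij.2 : Fin n)) : MatIdx n)) ∘ Prod.map e e
    with hF
  have heq : paddedPerFormLex ℂ n n = rename F (perPoly (Fin n) ℂ) := by
    rw [paddedPerFormLex_eq, show (X (toLex ((0 : Fin n), (0 : Fin n))) : MvPolynomial (MatIdx n) ℂ) ^ (n - n) = 1 by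
      rw [Nat.sub_self, pow_zero], one_mul, hper, rename_rename]
  have hext : (aeval fun ij => (X (F ij) : MvPolynomial (MatIdx n) ℂ)) = rename F :=
    MvPolynomial.algHom_ext fun i => by rw [aeval_X, rename_X]
  refine HasDetRepr.of_isProjection_holds h ⟨fun ij => X (F ij), fun ij => Or.inl ⟨_, rfl⟩, ?_⟩
  rw [hext, heq]

/-- **`dc(per_n) ≤ s` transfers the inner permanent's multiplicities into the padded determinant,
effectively**: `P_n(μ) = mult_{μ*} ℂ[Δ_n(per_n)] ≤ K_{n+j}((μ♯(n+j))*)` for every `μ ⊢ nδ` (`≤ n²` parts)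
and every `j` with `n + j ≥ (n+1)·2(s+1)^9 + 1`. [this crux, k16] -/
theorem per_inner_le_det_rowLift_of_hasDetRepr (n : ℕ) [NeZero n] {s : ℕ} (hs : 1 ≤ s)
    (hdc : HasDetRepr (perPoly (Fin n) ℂ) s) (δ : ℕ) (μ : Nat.Partition (n * δ))
    (hμ : μ.parts.card ≤ n * n) (j : ℕ) [NeZero (n + j)] (hj : (n + 1) * (2 * (s + 1) ^ 9) + 1 ≤ n + j) :
    orbitMultiplicity ℂ (paddedPerFormLex ℂ n n) n (partitionWeightLex n μ) ≤
      orbitMultiplicity ℂ (detFormLex ℂ (n + j)) (n + j) (partitionWeightLex (n + j) (rowLift μ j)) :=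
  orbitMultiplicity_le_det_rowLift_of_hasDetRepr (paddedPerFormLex_isHomogeneous ℂ le_rfl) hs
    (hasDetRepr_paddedPerFormLex_self hdc) μ hμ j hj

/-- **Unconditional explicit level (Grenet)**: `P_n(μ) ≤ K_{n+j}((μ♯(n+j))*)` whenever
`n + j ≥ (n+1)·2^{9n+1} + 1` (`dc(per_n) ≤ 2ⁿ - 1`, Grenet 2011). An explicit level for
`P_n(μ) ≤ K∞(μ)` of `…RayStability.lean`. [Grenet 2011 Thm. 1; this crux, k16] -/
theorem per_inner_le_det_rowLift_grenet (n : ℕ) [NeZero n] (δ : ℕ) (μ : Nat.Partition (n * δ))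
    (hμ : μ.parts.card ≤ n * n) (j : ℕ) [NeZero (n + j)] (hj : (n + 1) * 2 ^ (9 * n + 1) + 1 ≤ n + j) :
    orbitMultiplicity ℂ (paddedPerFormLex ℂ n n) n (partitionWeightLex n μ) ≤
      orbitMultiplicity ℂ (detFormLex ℂ (n + j)) (n + j) (partitionWeightLex (n + j) (rowLift μ j)) := by
  have hn : 1 ≤ n := Nat.one_le_iff_ne_zero.mpr (NeZero.ne n)
  have h2 : 1 ≤ 2 ^ n - 1 := by
    have : 2 ≤ 2 ^ n := by
      calc 2 = 2 ^ 1 := by norm_num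
        _ ≤ 2 ^ n := Nat.pow_le_pow_right (by norm_num) hn
    omega
  have hdc : HasDetRepr (perPoly (Fin n) ℂ) (2 ^ n - 1) :=
    HasDetRepr.mono_holds (hasDetRepr_determinantalComplexity_holds (perPoly (Fin n) ℂ))
      (determinantalComplexity_perPoly_le_holds ℂ n hn)
  refine per_inner_le_det_rowLift_of_hasDetRepr n h2 hdc δ μ hμ j ?_
  have hpow : 2 ^ n - 1 + 1 = 2 ^ n := by have := @Nat.one_le_two_pow n; omega
  rw [hpow, ← pow_mul, show 2 * (2 : ℕ) ^ (n * 9) = 2 ^ (9 * n + 1) by ring]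
  exact hj

/-- **The inner obstruction principle.**  If for some `μ ⊢ nδ` (`≤ n²` parts) and some level `n + j` the
unpadded permanent beats the determinant on the Kadish–Landsberg ray — `K_{n+j}((μ♯(n+j))*) < P_n(μ)` —
then `dc(per_n) > s` for every `s ≥ 1` with `(n+1)·2(s+1)^9 + 1 ≤ n + j`. [this crux, k16; cf.
Mulmuley–Sohoni 2001 §4 (border principle)] -/
theorem lt_determinantalComplexity_perPoly_of_innerObstruction (n : ℕ) [NeZero n] (δ : ℕ)
    (μ : Nat.Partition (n * δ)) (hμ : μ.parts.card ≤ n * n) (j : ℕ) [NeZero (n + j)]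
    (hobs : orbitMultiplicity ℂ (detFormLex ℂ (n + j)) (n + j) (partitionWeightLex (n + j) (rowLift μ j)) <
      orbitMultiplicity ℂ (paddedPerFormLex ℂ n n) n (partitionWeightLex n μ))
    (s : ℕ) (hs : 1 ≤ s) (hsj : (n + 1) * (2 * (s + 1) ^ 9) + 1 ≤ n + j) :
    s < Literature.Computability.AlgebraicComplexity.determinantalComplexity (perPoly (Fin n) ℂ) := by
  by_contra hle
  rw [not_lt] at hle
  have hdc : HasDetRepr (perPoly (Fin n) ℂ) s :=
    HasDetRepr.mono_holds (hasDetRepr_determinantalComplexity_holds (perPoly (Fin n) ℂ)) hle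
  exact (lt_irrefl _) (hobs.trans_le (per_inner_le_det_rowLift_of_hasDetRepr n hs hdc δ μ hμ j hsj))

end

end Summit.ValiantsHypothesis.ValiantsHypothesis.Theorems.ValuativeFlip
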